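import Mathlib.Probability.Moments.SubGaussian
import Mathlib.Analysis.MeanInequalitiesPow
import Literature.MathematicalPhysics.QuantumFieldTheory.Balaban1983to89.B1Eq324WeightedCumulantLeaf

/-!
# `Balaban1983to89.B1Eq324GaussianMomentLeaf` — T. Bałaban, *(Higgs)₂,₃ quantum fields in a finite volume. I. A lower bound*,
Commun. Math. Phys. **85** (1982) 603–626 [Balaban1982Higgs1], (3.24) p. 616 / (3.59) p. 623: **THE MOMENT INPUT OF LEAF (b) OF
THE CUMULANT EXPANSION — `L²(μ)`-BOUNDS `‖Vᵏ‖₂ ≤ M` FOR A POLYNOMIAL `V` IN (SUB-)GAUSSIAN FLUCTUATION VARIABLES**, and leaf (b)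
of `B1Eq324WeightedCumulantLeaf` with that input DISCHARGED — theorems + three definitions with bodies (the polynomial carrier `poly`,
the constants `momentConst`, `polyMomentBound`); no `Prop`-valued fact

statement-level skeleton of published theorems with citation tags; proofs where landed; nothing here is a claim about the Yang–Mills mass gap

PDF held: `paper:balaban1982-cmp85-higgs23-i` (journal page = PDF page + 602); pp. 616–617 [PDF 14–15] re-read this session in the
materialised text `~/.lit/texts/paper-balaban1982-cmp85-higgs23-i/p0014.txt`, `p0015.txt`.

CITATION HEADER (lean-in-tree rule).  lit-balaban typed skeleton (HOME `run/shared/lean/pub/lit-balaban/`), unit `lit-balaban-r14`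
gen 25 (B1 fold owner `literature-prover-lit-balaban-r14-g25-0`; TAKING #2 line HOME/STATUS.md 2026-08-24T18:03:38Z, free-target
protocol G.5-34 (d)).  SKELETON rows **B1.Eq3.24** / **B1.Eq3.59** (owner r12; both `typed`, *"DISCHARGED MODULO NAMED LEAVES"*).
r14's `B1Eq324WeightedCumulantLeaf` (p383907) reduced LEAF (b) — print's unweighted cumulants versus those of the χ-weighted law —
to two displayed inputs: the tail `⟨1 − χ⟩` (leaf-(a) data, `B1Eq324SmallFieldLeaf`) and `L²(μ)`-MOMENT BOUNDS `‖Vᵏ‖_{L²(μ)} ≤ M`,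
`1 ≤ k ≤ n̄`, for the polynomial `V` under the UNWEIGHTED Gaussian law.  THIS FILE SUPPLIES THE SECOND INPUT for every polynomial
`V = Σ_{i∈I} aᵢ Π_{j∈Jᵢ} X_{ij}` of degree `≤ q` in random variables `X_{ij}` with a SUB-GAUSSIAN moment generating function
(Mathlib's `ProbabilityTheory.HasSubgaussianMGF X c μ`: `⟨e^{tX}⟩ ≤ e^{ct²/2}` for all `t`) — which the Gaussian fluctuation
variables of print have with equality (p. 617: *"The fields A′_j … are independent Gaussian random variables with the covariances
C^{(j),L^jε}"*; in the tree: the typer's `HiggsFluctMeasureCov.integral_exp_siteInner_fluctMeasure`, r14's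
`B1Eq324SmallFieldLeaf.integral_exp_mul_apply_fluctMeasure` `∫e^{sA′_b}dμ = e^{s²·bondVar b/2}`).  USED BY NAME, NOTHING RESTATED:
Mathlib's `HasSubgaussianMGF` (`integrable_exp_mul`, `mgf_le`, `memLp`, `aestronglyMeasurable`), `Real.pow_div_factorial_le_exp`,
`Real.pow_arith_mean_le_arith_mean_pow` (Jensen for `x ↦ xⁿ`), and r14's `B1Eq324WeightedCumulantLeaf.abs_sum_cumulantOf_sub_truncExp_le`
/ `leafBConst` (§5).

THE SOURCE TEXT (verbatim, p. 616).  *"The coefficients of the polynomial V are proportional to some positive powers of ε. The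
smallest such power is ε^{1/2} and ⟨Vⁿ⟩^T is the expression corresponding to the sum of connected graphs with exponentially decaying
propagators."* — the only two properties of `V` print uses: a POLYNOMIAL in the Gaussian fluctuation fields, with SMALL
coefficients.  The present file turns the first into the moment bound leaf (b) consumes; the coefficients enter through `Σᵢ|aᵢ|`.

WHAT IS PROVED (0 `sorry`, standard axioms).
§1 SUB-GAUSSIAN M.G.F. ⇒ ALL ABSOLUTE MOMENTS: `abs_pow_le_factorial_mul_exp` (pointwise `|x|ᵐ ≤ m!·t^{−m}·(e^{tx} + e^{−tx})`,
  `t > 0`), **`integral_abs_pow_le_of_hasSubgaussianMGF`** (`∫|X|ᵐ dμ ≤ 2·m!·t^{−m}·e^{ct²/2}` for every `t > 0`),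
  `integrable_abs_pow_of_hasSubgaussianMGF`.
§2 MONOMIALS: `prod_le_sum_pow_card` (pointwise `Π_{j∈s} yⱼ ≤ Σ_{j∈s} yⱼ^{|s|}`, `y ≥ 0`), **`integral_prod_abs_pow_le`**
  (`∫ Π_{j∈s}|Xⱼ|ᵐ ≤ |s|·2(m|s|)!·t^{−m|s|}·e^{ct²/2}`), `integrable_prod_abs_pow`.
§3 POLYNOMIALS (probability measure `μ`): the carrier **`poly I J a X ω := Σ_{i∈I} aᵢ Π_{j∈Jᵢ} X_{ij}(ω)`**, the constant
  **`momentConst q n c := 2(q+1)·(nq)!·e^{c/2}`** (`t = 1`; `one_le_momentConst`, `momentConst_mono`), `integral_monomial_abs_pow_le`,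
  `aestronglyMeasurable_poly`, `integrable_abs_poly_pow` and **`integral_abs_poly_pow_le`**: if every `X_{ij}` (`i ∈ I`, `j ∈ Jᵢ`)
  has `HasSubgaussianMGF (X i j) c μ` and `|Jᵢ| ≤ q`, then for every `n`, `∫ |V|ⁿ dμ ≤ (Σ_{i∈I}|aᵢ|)ⁿ · momentConst q n c`
  (weighted power mean with weights `|aᵢ|/Σ|a|`, then §2).
§4 THE SHAPES CONSUMED BY LEAF (b): `memLp_poly_pow` (`MemLp (Vᵏ) 2 μ`), **`sqrt_integral_poly_pow_sq_le`**
  (`√(∫(Vᵏ)² dμ) ≤ (Σ|aᵢ|)ᵏ·√(momentConst q (2k) c)`), and the single bound **`polyMomentBound`** /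
  `sqrt_integral_poly_pow_sq_le_polyMomentBound` (`… ≤ M := (max 1 Σ|aᵢ|)^{n̄}·√(momentConst q (2n̄) c)` for all `1 ≤ k ≤ n̄`,
  `one_le_polyMomentBound`) — EXACTLY `hV2` / `hVM` / `hM` of `B1Eq324WeightedCumulantLeaf.abs_sum_cumulantOf_sub_truncExp_le`.
§5 KNITTING: **`abs_sum_cumulantOf_sub_truncExp_le_poly`** — LEAF (b) FOR A POLYNOMIAL IN SUB-GAUSSIAN VARIABLES with the moment
  input DISCHARGED: `|Σ_{n=1}^{n̄} (κₙ(⟨V^·⟩_μ) − ⟨Vⁿ⟩ᵀ_{χμ})/n!| ≤ leafBConst n̄ M · √⟨1 − χ⟩`, `M = polyMomentBound …`; the only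
  remaining inputs are `⟨χ⟩ ≥ ½` and the bound `|V| ≤ B` on `{χ ≠ 0}` (p27's `hVB`).
HONEST SCOPE.  (i) The identification of print's `V^{(k)}` ((3.17)–(3.19) p. 615 / (3.51)–(3.53) p. 621) as a `poly I J a X` with
explicit `(I, aᵢ, q, c)` — `|I| ≲ |T₁^{(k)}|`, `aᵢ = O((L^kε)^{1/2})`, `q ≤ 4`, `c` = the covariance diagonal of Prop. 2.3 — is NOT
made here: the tree's (3.59) carrier (`B1LowerBound.C359Setting`, p27's `Realization`) keeps `V` abstract; this file is the
generic moment bound such an identification would invoke.  (ii) The constants (`t = 1`, `2(q+1)(nq)!e^{c/2}`) are ours and crude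
(no Wick/hypercontractive sharpness is attempted); print has `O(1)`.  (iii) Leaf (c) (the lemma of [2] p. 152, NOT HELD) untouched;
rows B1.Eq3.24 / B1.Eq3.59 keep their heads.  NOT summit progress; NOT Clay.
-/

open MeasureTheory ProbabilityTheory Finset
open scoped Nat NNReal

namespace Literature.MathematicalPhysics.QuantumFieldTheory.Balaban1983to89.B1Eq324GaussianMomentLeaf

noncomputable section

/-! ## §1 A sub-Gaussian moment generating function bounds every absolute moment -/

section SubGaussian

/-- Pointwise: `|x|ᵐ ≤ m!·t^{−m}·(e^{tx} + e^{−tx})` for `t > 0` (`(t|x|)ᵐ/m! ≤ e^{t|x|} ≤ e^{tx} + e^{−tx}`,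
`Real.pow_div_factorial_le_exp`) — the elementary step from exponential to polynomial moments behind the Gaussian moment input of
(3.24). [cite: Balaban1982Higgs1, (3.24) p.616] -/
theorem abs_pow_le_factorial_mul_exp (x : ℝ) (m : ℕ) {t : ℝ} (ht : 0 < t) :
    |x| ^ m ≤ (m ! : ℝ) * (t ^ m)⁻¹ * (Real.exp (t * x) + Real.exp (-t * x)) := by
  have h1 : (t * |x|) ^ m / (m ! : ℝ) ≤ Real.exp (t * |x|) :=
    Real.pow_div_factorial_le_exp _ (mul_nonneg ht.le (abs_nonneg x)) m
  have h2 : Real.exp (t * |x|) ≤ Real.exp (t * x) + Real.exp (-t * x) := by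
    rcases le_or_gt 0 x with hx | hx
    · rw [abs_of_nonneg hx]; linarith [Real.exp_pos (-t * x)]
    · rw [abs_of_neg hx, show t * -x = -t * x by ring]; linarith [Real.exp_pos (t * x)]
  have hf : (0 : ℝ) < m ! := by positivity
  have htm : 0 < t ^ m := pow_pos ht m
  rw [mul_pow, div_le_iff₀ hf] at h1
  calc |x| ^ m = (m ! : ℝ) * (t ^ m)⁻¹ * (t ^ m * |x| ^ m / (m ! : ℝ)) := by
        field_simp
    _ ≤ (m ! : ℝ) * (t ^ m)⁻¹ * (Real.exp (t * x) + Real.exp (-t * x)) := by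
        refine mul_le_mul_of_nonneg_left ?_ (by positivity)
        rw [div_le_iff₀ hf]; exact h1.trans (by nlinarith [Real.exp_pos (t*x), Real.exp_pos (-t*x), h2])

variable {Ω : Type*} {mΩ : MeasurableSpace Ω} {μ : Measure Ω}

/-- **ALL ABSOLUTE MOMENTS FROM A SUB-GAUSSIAN M.G.F.**: if `⟨e^{tX}⟩_μ ≤ e^{ct²/2}` for all `t` (Mathlib's
`HasSubgaussianMGF X c μ`; the Gaussian fluctuation variables of p. 617 have it with equality), then for every `m` and every `t > 0`
`∫ |X|ᵐ dμ ≤ 2·m!·t^{−m}·e^{ct²/2}`. [cite: Balaban1982Higgs1, (3.24) p.616] -/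
theorem integral_abs_pow_le_of_hasSubgaussianMGF {X : Ω → ℝ} {c : ℝ≥0} (h : HasSubgaussianMGF X c μ) (m : ℕ)
    {t : ℝ} (ht : 0 < t) :
    ∫ ω, |X ω| ^ m ∂μ ≤ 2 * (m ! : ℝ) * (t ^ m)⁻¹ * Real.exp (c * t ^ 2 / 2) := by
  have hint : Integrable (fun ω => (m ! : ℝ) * (t ^ m)⁻¹ * (Real.exp (t * X ω) + Real.exp (-t * X ω))) μ :=
    ((h.integrable_exp_mul t).add (h.integrable_exp_mul (-t))).const_mul _
  calc ∫ ω, |X ω| ^ m ∂μ ≤ ∫ ω, (m ! : ℝ) * (t ^ m)⁻¹ * (Real.exp (t * X ω) + Real.exp (-t * X ω)) ∂μ :=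
        integral_mono_of_nonneg (ae_of_all _ fun ω => pow_nonneg (abs_nonneg _) m) hint
          (ae_of_all _ fun ω => abs_pow_le_factorial_mul_exp (X ω) m ht)
    _ = (m ! : ℝ) * (t ^ m)⁻¹ * (mgf X μ t + mgf X μ (-t)) := by
        rw [integral_const_mul, integral_add (h.integrable_exp_mul t) (h.integrable_exp_mul (-t))]; rfl
    _ ≤ (m ! : ℝ) * (t ^ m)⁻¹ * (Real.exp (c * t ^ 2 / 2) + Real.exp (c * t ^ 2 / 2)) := by
        gcongr
        · exact h.mgf_le t
        · have := h.mgf_le (-t); rwa [neg_sq] at this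
    _ = _ := by ring

/-- `|X|ᵐ` is integrable for a sub-Gaussian `X` (every `m`; Mathlib's `HasSubgaussianMGF.memLp`).
[cite: Balaban1982Higgs1, (3.24) p.616] -/
theorem integrable_abs_pow_of_hasSubgaussianMGF {X : Ω → ℝ} {c : ℝ≥0} (h : HasSubgaussianMGF X c μ) (m : ℕ) :
    Integrable (fun ω => |X ω| ^ m) μ := by
  rcases Nat.eq_zero_or_pos m with hm | hm
  · subst hm; simp only [pow_zero]
    have := h.integrable_exp_mul 0
    simpa using this
  · have := (h.memLp (m : ℝ≥0)).integrable_norm_pow (p := m) (Nat.pos_iff_ne_zero.1 hm)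
    simpa [Real.norm_eq_abs] using this

end SubGaussian

/-! ## §2 Monomials -/

section Monomial

variable {Ω : Type*} {mΩ : MeasurableSpace Ω} {μ : Measure Ω} {κ : Type*}

/-- Pointwise: `Π_{j∈s} yⱼ ≤ Σ_{j∈s} yⱼ^{|s|}` for `y ≥ 0` on a nonempty `s` (every factor is at most the largest one).
[cite: Balaban1982Higgs1, (3.24) p.616] -/
theorem prod_le_sum_pow_card (s : Finset κ) (hs : s.Nonempty) (y : κ → ℝ) (hy : ∀ j ∈ s, 0 ≤ y j) :
    ∏ j ∈ s, y j ≤ ∑ j ∈ s, y j ^ s.card := by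
  obtain ⟨j₀, hj₀, hmax⟩ := s.exists_max_image y hs
  calc ∏ j ∈ s, y j ≤ ∏ _j ∈ s, y j₀ := Finset.prod_le_prod hy hmax
    _ = y j₀ ^ s.card := Finset.prod_const _
    _ ≤ ∑ j ∈ s, y j ^ s.card :=
        Finset.single_le_sum (f := fun j => y j ^ s.card) (fun j hj => pow_nonneg (hy j hj) _) hj₀

/-- **MONOMIAL MOMENTS**: for sub-Gaussian `Xⱼ` (`j ∈ s`, `s` nonempty, one parameter `c`) and every `m`, `t > 0`:
`∫ Π_{j∈s} |Xⱼ|ᵐ dμ ≤ |s|·2·(m|s|)!·t^{−m|s|}·e^{ct²/2}` (§1 after `prod_le_sum_pow_card`). [cite: Balaban1982Higgs1, (3.24) p.616] -/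
theorem integral_prod_abs_pow_le (s : Finset κ) (hs : s.Nonempty) {X : κ → Ω → ℝ} {c : ℝ≥0}
    (h : ∀ j ∈ s, HasSubgaussianMGF (X j) c μ) (m : ℕ) {t : ℝ} (ht : 0 < t) :
    ∫ ω, ∏ j ∈ s, |X j ω| ^ m ∂μ
      ≤ s.card * (2 * ((m * s.card) ! : ℝ) * (t ^ (m * s.card))⁻¹ * Real.exp (c * t ^ 2 / 2)) := by
  have hint : ∀ j ∈ s, Integrable (fun ω => |X j ω| ^ (m * s.card)) μ :=
    fun j hj => integrable_abs_pow_of_hasSubgaussianMGF (h j hj) _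
  calc ∫ ω, ∏ j ∈ s, |X j ω| ^ m ∂μ ≤ ∫ ω, ∑ j ∈ s, |X j ω| ^ (m * s.card) ∂μ := by
        refine integral_mono_of_nonneg (ae_of_all _ fun ω => Finset.prod_nonneg fun j _ => by positivity)
          (integrable_finsetSum s hint) (ae_of_all _ fun ω => ?_)
        have := prod_le_sum_pow_card s hs (fun j => |X j ω| ^ m) (fun j _ => by positivity)
        simpa only [← pow_mul] using this
    _ = ∑ j ∈ s, ∫ ω, |X j ω| ^ (m * s.card) ∂μ := integral_finsetSum s hint
    _ ≤ ∑ _j ∈ s, 2 * ((m * s.card) ! : ℝ) * (t ^ (m * s.card))⁻¹ * Real.exp (c * t ^ 2 / 2) :=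
        Finset.sum_le_sum fun j hj => integral_abs_pow_le_of_hasSubgaussianMGF (h j hj) _ ht
    _ = _ := by rw [Finset.sum_const, nsmul_eq_mul]

/-- Monomials in sub-Gaussian variables are integrable to every power (finite measure). [cite: Balaban1982Higgs1, (3.24) p.616] -/
theorem integrable_prod_abs_pow (s : Finset κ) {X : κ → Ω → ℝ} {c : ℝ≥0} [IsFiniteMeasure μ]
    (h : ∀ j ∈ s, HasSubgaussianMGF (X j) c μ) (m : ℕ) :
    Integrable (fun ω => ∏ j ∈ s, |X j ω| ^ m) μ := by
  rcases s.eq_empty_or_nonempty with hs | hs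
  · subst hs; simp
  have hmeas : AEStronglyMeasurable (fun ω => ∏ j ∈ s, |X j ω| ^ m) μ :=
    Finset.aestronglyMeasurable_fun_prod s fun j hj =>
      ((h j hj).aestronglyMeasurable.norm.pow m).congr (ae_of_all _ fun ω => by simp [Real.norm_eq_abs])
  refine Integrable.mono' (integrable_finsetSum s fun j hj => integrable_abs_pow_of_hasSubgaussianMGF (h j hj) (m * s.card))
    hmeas (ae_of_all _ fun ω => ?_)
  rw [Real.norm_eq_abs, abs_of_nonneg (Finset.prod_nonneg fun j _ => by positivity)]
  have := prod_le_sum_pow_card s hs (fun j => |X j ω| ^ m) (fun j _ => by positivity)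
  simpa only [← pow_mul] using this

end Monomial

/-! ## §3 Polynomials in sub-Gaussian variables -/

section Poly

variable {Ω : Type*} {mΩ : MeasurableSpace Ω} {μ : Measure Ω} {ι κ : Type*}

/-- THE POLYNOMIAL CARRIER `V(ω) = Σ_{i∈I} aᵢ · Π_{j∈Jᵢ} X_{ij}(ω)` — a polynomial (monomial index set `I`, coefficients `aᵢ`,
variables `X_{ij}`, `j ∈ Jᵢ`) in fluctuation variables; print's `V^{(k)}` is of this form in the Gaussian fields `A′`, `φ′`
((3.17)–(3.19), (3.51)–(3.53)). [cite: Balaban1982Higgs1, (3.24) p.616] -/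
def poly (I : Finset ι) (J : ι → Finset κ) (a : ι → ℝ) (X : ι → κ → Ω → ℝ) (ω : Ω) : ℝ :=
  ∑ i ∈ I, a i * ∏ j ∈ J i, X i j ω

/-- THE MOMENT CONSTANT at `t = 1`: `momentConst q n c := 2·(q+1)·(nq)!·e^{c/2}` — bounds the `n`-th absolute moment of every
monomial of degree `≤ q` in sub-Gaussian(`c`) variables under a probability measure. [cite: Balaban1982Higgs1, (3.24) p.616] -/
def momentConst (q n : ℕ) (c : ℝ≥0) : ℝ := 2 * (q + 1) * ((n * q) ! : ℝ) * Real.exp (c / 2)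

/-- `1 ≤ momentConst q n c`. [cite: Balaban1982Higgs1, (3.24) p.616] -/
theorem one_le_momentConst (q n : ℕ) (c : ℝ≥0) : 1 ≤ momentConst q n c := by
  unfold momentConst
  have h1 : (1 : ℝ) ≤ (n * q) ! := by exact_mod_cast Nat.one_le_iff_ne_zero.2 (Nat.factorial_ne_zero _)
  have h2 : (1 : ℝ) ≤ Real.exp (c / 2) := Real.one_le_exp (by positivity)
  have h3 : (1 : ℝ) ≤ q + 1 := by norm_cast; omega
  nlinarith [mul_le_mul h3 h1 zero_le_one (by positivity),
    mul_nonneg (by positivity : (0:ℝ) ≤ q + 1) (by positivity : (0:ℝ) ≤ (n*q)!)]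

/-- `momentConst` is monotone in the moment order `n`. [cite: Balaban1982Higgs1, (3.24) p.616] -/
theorem momentConst_mono (q : ℕ) {n₁ n₂ : ℕ} (hn : n₁ ≤ n₂) (c : ℝ≥0) : momentConst q n₁ c ≤ momentConst q n₂ c := by
  unfold momentConst
  have hfac : ((n₁ * q) ! : ℝ) ≤ (n₂ * q) ! := by exact_mod_cast Nat.factorial_le (Nat.mul_le_mul_right q hn)
  have he : 0 < Real.exp (↑c / 2) := Real.exp_pos _
  nlinarith [mul_le_mul_of_nonneg_left hfac (by positivity : (0:ℝ) ≤ 2 * (q + 1))]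

variable [IsProbabilityMeasure μ] {I : Finset ι} {J : ι → Finset κ} {a : ι → ℝ} {X : ι → κ → Ω → ℝ} {c : ℝ≥0} {q : ℕ}

/-- Each monomial's `n`-th absolute moment is `≤ momentConst q n c` (`|Jᵢ| ≤ q`; the empty monomial is the constant `1`).
[cite: Balaban1982Higgs1, (3.24) p.616] -/
theorem integral_monomial_abs_pow_le (h : ∀ i ∈ I, ∀ j ∈ J i, HasSubgaussianMGF (X i j) c μ)
    (hq : ∀ i ∈ I, (J i).card ≤ q) {i : ι} (hi : i ∈ I) (n : ℕ) :
    ∫ ω, |∏ j ∈ J i, X i j ω| ^ n ∂μ ≤ momentConst q n c := by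
  have hK1 := one_le_momentConst q n c
  rcases (J i).eq_empty_or_nonempty with hs | hs
  · simp only [hs, Finset.prod_empty, abs_one, one_pow, integral_const, probReal_univ, smul_eq_mul, mul_one]
    exact hK1
  have hrw : (fun ω => |∏ j ∈ J i, X i j ω| ^ n) = fun ω => ∏ j ∈ J i, |X i j ω| ^ n := by
    funext ω; rw [Finset.abs_prod, Finset.prod_pow]
  rw [hrw]
  refine (integral_prod_abs_pow_le (J i) hs (h i hi) n zero_lt_one).trans ?_
  simp only [one_pow, inv_one, mul_one]
  unfold momentConst
  have hcard : ((J i).card : ℝ) ≤ q := by exact_mod_cast hq i hi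
  have hfac : ((n * (J i).card) ! : ℝ) ≤ (n * q) ! := by
    exact_mod_cast Nat.factorial_le (Nat.mul_le_mul_left n (hq i hi))
  have he : 0 < Real.exp (↑c / 2) := Real.exp_pos _
  nlinarith [mul_le_mul hcard hfac (by positivity) (by positivity),
    mul_nonneg (Nat.cast_nonneg (J i).card) (by positivity : (0:ℝ) ≤ (n*q)!)]

omit [IsProbabilityMeasure μ] in
/-- The polynomial is a.e.-strongly measurable (finite sums of products of the sub-Gaussian, hence measurable, variables).
[cite: Balaban1982Higgs1, (3.24) p.616] -/
theorem aestronglyMeasurable_poly (h : ∀ i ∈ I, ∀ j ∈ J i, HasSubgaussianMGF (X i j) c μ) :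
    AEStronglyMeasurable (poly I J a X) μ := by
  unfold poly
  refine Finset.aestronglyMeasurable_fun_sum I fun i hi => ?_
  exact (Finset.aestronglyMeasurable_fun_prod (J i) fun j hj => (h i hi j hj).aestronglyMeasurable).const_mul _

/-- Pointwise Jensen step: with `S = Σ_{i∈I}|aᵢ| > 0`, `|V(ω)|ⁿ ≤ Sⁿ · Σ_{i∈I} (|aᵢ|/S)·|Π_{j∈Jᵢ}X_{ij}(ω)|ⁿ`
(`Real.pow_arith_mean_le_arith_mean_pow`); private plumbing. [folklore] -/
private theorem abs_poly_pow_le (n : ℕ) (hS : 0 < ∑ i ∈ I, |a i|) (ω : Ω) :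
    |poly I J a X ω| ^ n
      ≤ (∑ i ∈ I, |a i|) ^ n * ∑ i ∈ I, |a i| / (∑ i ∈ I, |a i|) * |∏ j ∈ J i, X i j ω| ^ n := by
  set S := ∑ i ∈ I, |a i| with hSdef
  have hS0 : 0 ≤ S := hS.le
  have hw1 : ∑ i ∈ I, |a i| / S = 1 := by rw [← Finset.sum_div, div_self hS.ne']
  have h1 : |poly I J a X ω| ≤ ∑ i ∈ I, |a i| * |∏ j ∈ J i, X i j ω| :=
    (Finset.abs_sum_le_sum_abs _ _).trans (le_of_eq (Finset.sum_congr rfl fun i _ => abs_mul _ _))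
  have h2 : (∑ i ∈ I, |a i| * |∏ j ∈ J i, X i j ω|) = S * ∑ i ∈ I, |a i| / S * |∏ j ∈ J i, X i j ω| := by
    rw [Finset.mul_sum]; refine Finset.sum_congr rfl fun i _ => ?_; field_simp
  have h3 := Real.pow_arith_mean_le_arith_mean_pow I (fun i => |a i| / S) (fun i => |∏ j ∈ J i, X i j ω|)
    (fun i _ => div_nonneg (abs_nonneg _) hS0) hw1 (fun i _ => abs_nonneg _) n
  calc |poly I J a X ω| ^ n ≤ (∑ i ∈ I, |a i| * |∏ j ∈ J i, X i j ω|) ^ n :=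
        pow_le_pow_left₀ (abs_nonneg _) h1 n
    _ = S ^ n * (∑ i ∈ I, |a i| / S * |∏ j ∈ J i, X i j ω|) ^ n := by rw [h2, mul_pow]
    _ ≤ S ^ n * ∑ i ∈ I, |a i| / S * |∏ j ∈ J i, X i j ω| ^ n :=
        mul_le_mul_of_nonneg_left h3 (pow_nonneg hS0 n)

/-- `(pᵏ)² = |p|^{2k}`; private plumbing. [folklore] -/
private theorem pow_sq_eq_abs_pow (p : ℝ) (k : ℕ) : (p ^ k) ^ 2 = |p| ^ (2 * k) := by
  rw [pow_mul, sq_abs, ← pow_mul, ← pow_mul, mul_comm]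

/-- If all coefficients vanish the polynomial vanishes; private plumbing. [folklore] -/
private theorem poly_eq_zero_of_sum_abs (hS : ∑ i ∈ I, |a i| = 0) (ω : Ω) : poly I J a X ω = 0 := by
  have ha0 : ∀ i ∈ I, a i = 0 := fun i hi =>
    abs_eq_zero.1 (le_antisymm ((Finset.single_le_sum (fun i _ => abs_nonneg (a i)) hi).trans hS.le) (abs_nonneg _))
  exact Finset.sum_eq_zero fun i hi => by rw [ha0 i hi, zero_mul]

/-- Every power `|V|ⁿ` of the polynomial is integrable. [cite: Balaban1982Higgs1, (3.24) p.616] -/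
theorem integrable_abs_poly_pow (h : ∀ i ∈ I, ∀ j ∈ J i, HasSubgaussianMGF (X i j) c μ) (n : ℕ) :
    Integrable (fun ω => |poly I J a X ω| ^ n) μ := by
  have hmono : ∀ i ∈ I, Integrable (fun ω => |∏ j ∈ J i, X i j ω| ^ n) μ := fun i hi =>
    (integrable_prod_abs_pow (μ := μ) (J i) (h i hi) n).congr (ae_of_all _ fun ω => by
      simp only [Finset.abs_prod, Finset.prod_pow])
  have hS0 : 0 ≤ ∑ i ∈ I, |a i| := Finset.sum_nonneg fun i _ => abs_nonneg _
  rcases hS0.eq_or_lt with hS00 | hSpos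
  · have hV : ∀ ω, poly I J a X ω = 0 := poly_eq_zero_of_sum_abs hS00.symm
    simp only [hV, abs_zero]
    exact integrable_const _
  have hmeas : AEStronglyMeasurable (fun ω => |poly I J a X ω| ^ n) μ :=
    ((aestronglyMeasurable_poly (a := a) h).norm.pow n).congr (ae_of_all _ fun ω => by simp [Real.norm_eq_abs])
  have hint : Integrable (fun ω => (∑ i ∈ I, |a i|) ^ n
      * ∑ i ∈ I, |a i| / (∑ i ∈ I, |a i|) * |∏ j ∈ J i, X i j ω| ^ n) μ :=
    (integrable_finsetSum I fun i hi => (hmono i hi).const_mul _).const_mul _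
  refine Integrable.mono' hint hmeas (ae_of_all _ fun ω => ?_)
  rw [Real.norm_eq_abs, abs_of_nonneg (pow_nonneg (abs_nonneg _) n)]
  exact abs_poly_pow_le n hSpos ω

/-- **THE `n`-TH ABSOLUTE MOMENT OF A POLYNOMIAL IN SUB-GAUSSIAN VARIABLES**: if every `X_{ij}` (`i ∈ I`, `j ∈ Jᵢ`) satisfies
`HasSubgaussianMGF (X i j) c μ` (`μ` a probability measure) and `|Jᵢ| ≤ q`, then for every `n`
`∫ |V|ⁿ dμ ≤ (Σ_{i∈I}|aᵢ|)ⁿ · momentConst q n c` — Jensen with weights `|aᵢ|/Σ|a|`, then `integral_monomial_abs_pow_le`.  The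
coefficients («proportional to some positive powers of ε») enter only through `Σ|aᵢ|`. [cite: Balaban1982Higgs1, (3.24) p.616] -/
theorem integral_abs_poly_pow_le (h : ∀ i ∈ I, ∀ j ∈ J i, HasSubgaussianMGF (X i j) c μ)
    (hq : ∀ i ∈ I, (J i).card ≤ q) (n : ℕ) :
    ∫ ω, |poly I J a X ω| ^ n ∂μ ≤ (∑ i ∈ I, |a i|) ^ n * momentConst q n c := by
  set S := ∑ i ∈ I, |a i| with hS
  have hS0 : 0 ≤ S := Finset.sum_nonneg fun i _ => abs_nonneg _
  have hK1 := one_le_momentConst q n c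
  have hmono : ∀ i ∈ I, Integrable (fun ω => |∏ j ∈ J i, X i j ω| ^ n) μ := fun i hi =>
    (integrable_prod_abs_pow (μ := μ) (J i) (h i hi) n).congr (ae_of_all _ fun ω => by
      simp only [Finset.abs_prod, Finset.prod_pow])
  rcases hS0.eq_or_lt with hS00 | hSpos
  · have hV : ∀ ω, poly I J a X ω = 0 := poly_eq_zero_of_sum_abs hS00.symm
    simp only [hV, abs_zero]
    rcases Nat.eq_zero_or_pos n with hn | hn
    · subst hn; simp only [pow_zero, integral_const, probReal_univ, smul_eq_mul, one_mul]; exact hK1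
    · rw [zero_pow hn.ne', integral_zero]; exact mul_nonneg (pow_nonneg hS0 _) (by linarith)
  have hw1 : ∑ i ∈ I, |a i| / S = 1 := by rw [← Finset.sum_div, div_self hSpos.ne']
  have hint : Integrable (fun ω => S ^ n * ∑ i ∈ I, |a i| / S * |∏ j ∈ J i, X i j ω| ^ n) μ :=
    (integrable_finsetSum I fun i hi => (hmono i hi).const_mul _).const_mul _
  calc ∫ ω, |poly I J a X ω| ^ n ∂μ ≤ ∫ ω, S ^ n * ∑ i ∈ I, |a i| / S * |∏ j ∈ J i, X i j ω| ^ n ∂μ :=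
        integral_mono_of_nonneg (ae_of_all _ fun ω => by positivity) hint (ae_of_all _ fun ω => abs_poly_pow_le n hSpos ω)
    _ = S ^ n * ∑ i ∈ I, |a i| / S * ∫ ω, |∏ j ∈ J i, X i j ω| ^ n ∂μ := by
        rw [integral_const_mul, integral_finsetSum I fun i hi => (hmono i hi).const_mul _]
        congr 1; exact Finset.sum_congr rfl fun i _ => integral_const_mul _ _
    _ ≤ S ^ n * ∑ i ∈ I, |a i| / S * momentConst q n c := by
        refine mul_le_mul_of_nonneg_left (Finset.sum_le_sum fun i hi => ?_) (pow_nonneg hS0 n)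
        exact mul_le_mul_of_nonneg_left (integral_monomial_abs_pow_le h hq hi n) (div_nonneg (abs_nonneg _) hS0)
    _ = S ^ n * momentConst q n c := by rw [← Finset.sum_mul, hw1, one_mul]

/-! ## §4 The shapes consumed by leaf (b): `MemLp (Vᵏ) 2 μ` and `√(∫ (Vᵏ)² dμ) ≤ M` -/

/-- `Vᵏ ∈ L²(μ)` — hypothesis `hV2` of `B1Eq324WeightedCumulantLeaf.abs_sum_cumulantOf_sub_truncExp_le`.
[cite: Balaban1982Higgs1, (3.24) p.616] -/
theorem memLp_poly_pow (h : ∀ i ∈ I, ∀ j ∈ J i, HasSubgaussianMGF (X i j) c μ) (k : ℕ) :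
    MemLp (fun ω => poly I J a X ω ^ k) 2 μ := by
  have hmeas : AEStronglyMeasurable (fun ω => poly I J a X ω ^ k) μ := (aestronglyMeasurable_poly (a := a) h).pow k
  refine (memLp_two_iff_integrable_sq hmeas).2 ?_
  refine (integrable_abs_poly_pow (a := a) h (2 * k)).congr (ae_of_all _ fun ω => ?_)
  show |poly I J a X ω| ^ (2 * k) = (poly I J a X ω ^ k) ^ 2
  rw [pow_sq_eq_abs_pow]

/-- **`√(∫ (Vᵏ)² dμ) ≤ (Σ|aᵢ|)ᵏ · √(momentConst q (2k) c)`** — the `L²`-norm of `Vᵏ`. [cite: Balaban1982Higgs1, (3.24) p.616] -/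
theorem sqrt_integral_poly_pow_sq_le (h : ∀ i ∈ I, ∀ j ∈ J i, HasSubgaussianMGF (X i j) c μ)
    (hq : ∀ i ∈ I, (J i).card ≤ q) (k : ℕ) :
    Real.sqrt (∫ ω, (poly I J a X ω ^ k) ^ 2 ∂μ) ≤ (∑ i ∈ I, |a i|) ^ k * Real.sqrt (momentConst q (2 * k) c) := by
  have hS0 : 0 ≤ ∑ i ∈ I, |a i| := Finset.sum_nonneg fun i _ => abs_nonneg _
  have heq : ∫ ω, (poly I J a X ω ^ k) ^ 2 ∂μ = ∫ ω, |poly I J a X ω| ^ (2 * k) ∂μ :=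
    integral_congr_ae (ae_of_all _ fun ω => by
      show (poly I J a X ω ^ k) ^ 2 = |poly I J a X ω| ^ (2 * k)
      rw [pow_sq_eq_abs_pow])
  rw [heq]
  have h1 := integral_abs_poly_pow_le (a := a) h hq (2 * k)
  calc Real.sqrt (∫ ω, |poly I J a X ω| ^ (2 * k) ∂μ)
      ≤ Real.sqrt ((∑ i ∈ I, |a i|) ^ (2 * k) * momentConst q (2 * k) c) := Real.sqrt_le_sqrt h1
    _ = (∑ i ∈ I, |a i|) ^ k * Real.sqrt (momentConst q (2 * k) c) := by
        rw [Real.sqrt_mul (pow_nonneg hS0 _), pow_mul', Real.sqrt_sq (pow_nonneg hS0 _)]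

/-- THE SINGLE MOMENT BOUND FOR ALL ORDERS `k ≤ n̄`: `polyMomentBound I a q n̄ c := (max 1 (Σ|aᵢ|))^{n̄} · √(momentConst q (2n̄) c)`
— the `M` of `B1Eq324WeightedCumulantLeaf`. [cite: Balaban1982Higgs1, (3.24) p.616] -/
def polyMomentBound (I : Finset ι) (a : ι → ℝ) (q nbar : ℕ) (c : ℝ≥0) : ℝ :=
  max 1 (∑ i ∈ I, |a i|) ^ nbar * Real.sqrt (momentConst q (2 * nbar) c)

omit [IsProbabilityMeasure μ] in
/-- `1 ≤ polyMomentBound …` (hypothesis `hM` of leaf (b)). [cite: Balaban1982Higgs1, (3.24) p.616] -/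
theorem one_le_polyMomentBound (I : Finset ι) (a : ι → ℝ) (q nbar : ℕ) (c : ℝ≥0) : 1 ≤ polyMomentBound I a q nbar c := by
  unfold polyMomentBound
  have h1 : (1 : ℝ) ≤ max 1 (∑ i ∈ I, |a i|) ^ nbar := one_le_pow₀ (le_max_left _ _)
  have h2 : (1 : ℝ) ≤ Real.sqrt (momentConst q (2 * nbar) c) := by
    rw [← Real.sqrt_one]; exact Real.sqrt_le_sqrt (one_le_momentConst _ _ _)
  nlinarith

/-- **`√(∫ (Vᵏ)² dμ) ≤ polyMomentBound …` for all `1 ≤ k ≤ n̄`** — hypothesis `hVM` of leaf (b).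
[cite: Balaban1982Higgs1, (3.24) p.616] -/
theorem sqrt_integral_poly_pow_sq_le_polyMomentBound (h : ∀ i ∈ I, ∀ j ∈ J i, HasSubgaussianMGF (X i j) c μ)
    (hq : ∀ i ∈ I, (J i).card ≤ q) (nbar : ℕ) (k : ℕ) (_hk1 : 1 ≤ k) (hk2 : k ≤ nbar) :
    Real.sqrt (∫ ω, (poly I J a X ω ^ k) ^ 2 ∂μ) ≤ polyMomentBound I a q nbar c := by
  refine (sqrt_integral_poly_pow_sq_le h hq k).trans ?_
  unfold polyMomentBound
  have hS0 : 0 ≤ ∑ i ∈ I, |a i| := Finset.sum_nonneg fun i _ => abs_nonneg _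
  have h1 : (∑ i ∈ I, |a i|) ^ k ≤ max 1 (∑ i ∈ I, |a i|) ^ nbar :=
    (pow_le_pow_left₀ hS0 (le_max_right _ _) k).trans (pow_le_pow_right₀ (le_max_left _ _) hk2)
  have h2 : Real.sqrt (momentConst q (2 * k) c) ≤ Real.sqrt (momentConst q (2 * nbar) c) :=
    Real.sqrt_le_sqrt (momentConst_mono q (Nat.mul_le_mul_left 2 hk2) c)
  exact mul_le_mul h1 h2 (Real.sqrt_nonneg _) (le_trans (pow_nonneg hS0 k |>.trans h1) le_rfl |> fun _ =>
    pow_nonneg (zero_le_one.trans (le_max_left _ _)) _)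

end Poly

/-! ## §5 Knitting: leaf (b) for a polynomial in sub-Gaussian variables, moment input discharged -/

section Knitting

open Literature.Probability.LatticeModels (cumulantOf)
open Literature.MathematicalPhysics.QuantumFieldTheory.Balaban1983to89.B10Eq24Cumulant (nmoment truncExp chiMeasure)
open B1Eq324WeightedCumulantLeaf (leafBConst abs_sum_cumulantOf_sub_truncExp_le)

variable {Ω : Type*} {mΩ : MeasurableSpace Ω} {μ : Measure Ω} [IsProbabilityMeasure μ] {ι κ : Type*}
  {I : Finset ι} {J : ι → Finset κ} {a : ι → ℝ} {X : ι → κ → Ω → ℝ} {c : ℝ≥0} {q : ℕ} {χ : Ω → ℝ} {B : ℝ}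

/-- **LEAF (b) OF (3.24)/(3.59) FOR A POLYNOMIAL `V` IN SUB-GAUSSIAN FLUCTUATION VARIABLES, MOMENT INPUT DISCHARGED**: `μ` a
probability measure, `V = Σ_{i∈I} aᵢ Π_{j∈Jᵢ} X_{ij}` with every `X_{ij}` sub-Gaussian(`c`) under `μ` and `|Jᵢ| ≤ q`; `χ`
measurable, `0 ≤ χ ≤ 1`, `⟨χ⟩ ≥ ½`, `|V| ≤ B` on `{χ ≠ 0}`.  Then
`|Σ_{n=1}^{n̄} (κₙ(⟨V^·⟩_μ) − ⟨Vⁿ⟩ᵀ_{χμ})/n!| ≤ leafBConst n̄ M · √⟨1 − χ⟩` with `M = polyMomentBound I a q n̄ c`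
(`B1Eq324WeightedCumulantLeaf.abs_sum_cumulantOf_sub_truncExp_le` with `hM`, `hV2`, `hVM` supplied by §4).
[cite: Balaban1982Higgs1, (3.24) p.616] -/
theorem abs_sum_cumulantOf_sub_truncExp_le_poly (h : ∀ i ∈ I, ∀ j ∈ J i, HasSubgaussianMGF (X i j) c μ)
    (hq : ∀ i ∈ I, (J i).card ≤ q) (hχm : Measurable χ) (hχ0 : ∀ ω, 0 ≤ χ ω) (hχ1 : ∀ ω, χ ω ≤ 1)
    (hZ : 1 / 2 ≤ ∫ ω, χ ω ∂μ) (hVB : ∀ ω, χ ω ≠ 0 → |poly I J a X ω| ≤ B) (nbar : ℕ) :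
    |∑ n ∈ Finset.Icc 1 nbar,
        (cumulantOf (nmoment (poly I J a X) μ) n - truncExp (poly I J a X) (chiMeasure μ χ) n) / (n ! : ℝ)|
      ≤ leafBConst nbar (polyMomentBound I a q nbar c) * Real.sqrt (∫ ω, (1 - χ ω) ∂μ) :=
  abs_sum_cumulantOf_sub_truncExp_le hχm hχ0 hχ1 hZ (aestronglyMeasurable_poly h).aemeasurable hVB nbar
    (one_le_polyMomentBound I a q nbar c) (fun k _ _ => memLp_poly_pow h k)
    (fun k hk1 hk2 => sqrt_integral_poly_pow_sq_le_polyMomentBound h hq nbar k hk1 hk2)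

end Knitting

end

end Literature.MathematicalPhysics.QuantumFieldTheory.Balaban1983to89.B1Eq324GaussianMomentLeaf
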